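import Summits.AtomisticToContinuum.Crystallization.Theorems.ChargedEnergyGapRoofCoverA
import HarnessLib

/-!
# NODE 76R «RoofCover» (lens-3 g76) — part 2 of 2 (sequel of `…ChargedEnergyGapRoofCoverA`)

Split for the 400-line cap by the landing lane (hand-2 g36); the module docstring of part 1 (`…ChargedEnergyGapRoofCoverA`) describes the whole node.  Same namespace; all FQNs unchanged.
0 sorry; standard axioms.
-/

noncomputable section
open scoped Classical
open Literature.MathematicalPhysics.StatisticalMechanics Literature.Geometry.DiscreteGeometry
open Summit.AtomisticToContinuum.Crystallization.Theses.PricedLinkCensus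
open Summit.AtomisticToContinuum.Crystallization.Theorems.ChargedEnergyGapNegative

namespace Summit.AtomisticToContinuum.Crystallization.Theorems.ChargedEnergyGapChartDial

/-! ## §4 The bridges (PROVED): χ-free ⟹ constant localisation factor; tame ⟹ `W∘vertices = φ∘(six-feet depth)`; (Z₀) ⟹ (D); (S♯) ∧ (I₃₆) ⟹ (S) -/

section Bridge

variable {ϱχ : ℝ} {m : ℕ} {D : Fin m → Set E3} {σ : Fin m → Bool}

/-- Sites of the octahedron of `(y, z)` are within `r₁ + r₂` of the pole `y`. [formal bookkeeping] -/
theorem dist_le_of_inOct {P : PeriodicConfiguration 3} {r₁ r₂ : ℝ} {y z x : E3} (hr₁ : 0 ≤ r₁) (hyz : dist y z ≤ r₂)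
    (hx : InOct P r₁ y z x) : dist y x ≤ r₁ + r₂ := by
  have hr₂ : 0 ≤ r₂ := dist_nonneg.trans hyz
  rcases hx.2 with h | h | ⟨ha, _⟩
  · rw [h, dist_self]; positivity
  · rw [h]; linarith
  · linarith

/-- No listed set in transition at `y`: every factor index is out of transition. [formal bookkeeping] -/
theorem not_inTransition_of_transMult_eq_zero {y : E3} (h : transMult ϱχ D y = 0) (i : Fin m) : ¬ InTransition ϱχ D i y := by
  intro hi
  unfold transMult at h
  rw [Finset.card_eq_zero, Finset.filter_eq_empty_iff] at h
  exact h (Finset.mem_univ i) hi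

/-- ★ **CONSTANCY OF THE LOCALISATION FACTOR**: two transition-free sites closer than `ϱχ/2` with factor `1` at one have factor `1` at the
other (a factor cannot jump between `0` and `1` without passing through transition: `dist(·, Dᵢ)` is `1`-Lipschitz). -/
theorem localFactor_eq_one_of_near {x x' : E3} (hϱχ : 0 < ϱχ) (hx : transMult ϱχ D x = 0) (hx' : transMult ϱχ D x' = 0)
    (hd : dist x x' < ϱχ / 2) (h1 : localFactor ϱχ D σ x = 1) : localFactor ϱχ D σ x' = 1 := by
  have hfx : ∀ i, (if σ i then profileWeight ϱχ (D i) x else 1 - profileWeight ϱχ (D i) x) = 1 := by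
    intro i
    rcases factor_eq_zero_or_one_of_not_inTransition (σ := σ) (not_inTransition_of_transMult_eq_zero hx i) with h0 | h1'
    · exfalso
      unfold localFactor at h1
      rw [Finset.prod_eq_zero (Finset.mem_univ i) h0] at h1
      exact zero_ne_one h1
    · exact h1'
  unfold localFactor
  refine Finset.prod_eq_one fun i _ => ?_
  rcases factor_eq_zero_or_one_of_not_inTransition (σ := σ) (not_inTransition_of_transMult_eq_zero hx' i) with h0 | h1'
  · exfalso
    have hL : Metric.infDist x (D i) ≤ Metric.infDist x' (D i) + dist x x' := Metric.infDist_le_infDist_add_dist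
    have hL' : Metric.infDist x' (D i) ≤ Metric.infDist x (D i) + dist x' x := Metric.infDist_le_infDist_add_dist
    rw [dist_comm] at hL'
    have hfi := hfx i
    cases hσ : σ i
    · simp only [hσ, Bool.false_eq_true, ↓reduceIte] at hfi h0
      have hpx : profileWeight ϱχ (D i) x = 0 := by linarith
      have hpx' : profileWeight ϱχ (D i) x' = 1 := by linarith
      have ha := infDist_le_of_profileWeight_eq_zero hϱχ hpx
      have hb := le_infDist_of_profileWeight_eq_one hϱχ hpx'
      linarith
    · simp only [hσ, ↓reduceIte] at hfi h0
      have ha := le_infDist_of_profileWeight_eq_one hϱχ hfi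
      have hb := infDist_le_of_profileWeight_eq_zero hϱχ h0
      linarith
  · exact h1'

/-- ★★ **THE TAME FRAME (PROVED)**: a χ-free tame clean non-plateau shell octahedron of a framed reference carries an anchored orthonormal frame
`(c, f, ρ)`, `ρ` in the window, whose six vertices are exactly its sites, with localisation factor `1`, weights `W = profileWeight`, and six feet
`q` within `r_f` of each other such that the six-feet depth of every vertex IS its distance to `C` — so `W∘vertices = φ∘feetDepth`. -/
theorem tame_frame {P : PeriodicConfiguration 3} {C X : Set E3} {r_f ϱ r₁ r₂ ρlo ρhi : ℝ} {y z : E3}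
    (hϱχ : 0 < ϱχ) (hr₁ : 0 ≤ r₁) (hsmall : 2 * (r₁ + r₂) < ϱχ / 2) (hlo : 0 < ρlo) (hFr : IsFramedOct P r₁ r₂ ρlo ρhi)
    (hy : y ∈ P.points) (hz : z ∈ P.points) (hd1 : r₁ < dist y z) (hd2 : dist y z ≤ r₂) (hclean : OctClean P r₁ X y z)
    (hplat : ¬OctPlateau P r₁ (siteW ϱχ D σ X ϱ C) y z) (hcf : OctChiFree ϱχ D P r₁ y z) (htm : OctTame r_f C P r₁ y z) :
    ∃ (c : E3) (f : Fin 3 → E3) (ρ : ℝ) (q : Fin 3 × Bool → E3), Orthonormal ℝ f ∧ 0 < ρ ∧ ρlo ≤ ρ ∧ ρ ≤ ρhi ∧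
      octVertex c f ρ 0 false = y ∧ octVertex c f ρ 0 true = z ∧ (∀ x, InOct P r₁ y z x ↔ ∃ i b, x = octVertex c f ρ i b) ∧
      (∀ u u', dist (q u) (q u') ≤ r_f) ∧ (∀ u, feetDepth c f ρ q u = Metric.infDist (octVertex c f ρ u.1 u.2) C) ∧
      (∀ x, InOct P r₁ y z x → localFactor ϱχ D σ x = 1) ∧ (∀ x, InOct P r₁ y z x → siteW ϱχ D σ X ϱ C x = profileWeight ϱ C x) ∧
      (fun p : Fin 3 × Bool => siteW ϱχ D σ X ϱ C (octVertex c f ρ p.1 p.2)) = fun u => depthProfile ϱ (feetDepth c f ρ q u) := by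
  obtain ⟨c, f, ρ, hf, hρ1, hρ2, hyv, hzv, hO⟩ := hFr y hy z hz hd1 hd2
  have hρ : 0 < ρ := lt_of_lt_of_le hlo hρ1
  have hvert : ∀ u : Fin 3 × Bool, InOct P r₁ y z (octVertex c f ρ u.1 u.2) := fun u => (hO _).2 ⟨u.1, u.2, rfl⟩
  have hnear : ∀ x x', InOct P r₁ y z x → InOct P r₁ y z x' → dist x x' < ϱχ / 2 := by
    intro x x' hx hx'
    have h1 := dist_le_of_inOct (P := P) hr₁ hd2 hx
    have h2 := dist_le_of_inOct (P := P) hr₁ hd2 hx'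
    have h3 := dist_triangle x y x'
    rw [dist_comm x y] at h3
    linarith
  -- the localisation factor is 1 on the octahedron
  have hone : ∃ x, InOct P r₁ y z x ∧ localFactor ϱχ D σ x = 1 := by
    by_contra hno
    push Not at hno
    have hzero : ∀ x, InOct P r₁ y z x → siteW ϱχ D σ X ϱ C x = 0 := by
      intro x hx
      rcases localFactor_eq_zero_or_one_of_transMult_eq_zero (σ := σ) (hcf x hx) with h0 | h1
      · unfold siteW
        split_ifs
        · rfl
        · rw [h0, zero_mul]
      · exact absurd h1 (hno x hx)
    exact hplat fun x x' hx hx' => by rw [hzero x hx, hzero x' hx']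
  obtain ⟨x₀, hx₀, hlf₀⟩ := hone
  have hlf : ∀ x, InOct P r₁ y z x → localFactor ϱχ D σ x = 1 := fun x hx =>
    localFactor_eq_one_of_near hϱχ (hcf x₀ hx₀) (hcf x hx) (hnear x₀ x hx₀ hx) hlf₀
  have hWx : ∀ x, InOct P r₁ y z x → siteW ϱχ D σ X ϱ C x = profileWeight ϱ C x := fun x hx => by
    unfold siteW
    rw [if_neg (hclean x hx), hlf x hx, one_mul]
  -- the feet
  obtain ⟨q, hq, hdiam⟩ := htm
  obtain ⟨q', hq'⟩ : ∃ q' : Fin 3 × Bool → E3, ∀ u, q' u = q (octVertex c f ρ u.1 u.2) := ⟨_, fun _ => rfl⟩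
  have hfd : ∀ u, feetDepth c f ρ q' u = Metric.infDist (octVertex c f ρ u.1 u.2) C := by
    intro u
    apply le_antisymm
    · have hle := Finset.inf'_le (fun u' => dist (octVertex c f ρ u.1 u.2) (q' u')) (Finset.mem_univ u)
      unfold feetDepth
      refine hle.trans_eq ?_
      rw [hq' u]
      exact (hq _ (hvert u)).2
    · unfold feetDepth
      refine Finset.le_inf' _ _ fun u' _ => ?_
      have hmem := (hq _ (hvert u')).1
      have hle := Metric.infDist_le_dist_of_mem (x := octVertex c f ρ u.1 u.2) hmem
      rw [Metric.infDist_closure] at hle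
      rw [hq' u']
      exact hle
  refine ⟨c, f, ρ, q', hf, hρ, hρ1, hρ2, hyv, hzv, hO, fun u u' => ?_, hfd, hlf, hWx, ?_⟩
  · rw [hq' u, hq' u']; exact hdiam _ _ (hvert u) (hvert u')
  · funext u
    rw [hWx _ (hvert u), profileWeight_eq_depthProfile, hfd]

/-- The frame-infimum is at most any anchored frame value. [formal bookkeeping] -/
theorem frameVal_le_of_mem {F : (Fin 3 × Bool → ℝ) → ℝ} {τ r₁ : ℝ} {W : E3 → ℝ} {P : PeriodicConfiguration 3} {y z : E3} {t b : ℝ}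
    (ht : t ∈ frameValSet F τ W P r₁ y z) (htb : t ≤ b) (hb : 0 ≤ b) : frameVal F τ W P r₁ y z ≤ b := by
  unfold frameVal
  by_cases hbd : BddBelow (frameValSet F τ W P r₁ y z)
  · exact (csInf_le hbd ht).trans htb
  · rw [Real.sInf_of_not_bddBelow hbd]; exact hb

/-- ★★★ **THE BRIDGE (Z₀) ⟹ (D) (PROVED)**, for any class, whenever the octahedra are small against the χ-scale (`2(r₁ + r₂) < ϱχ/2`) and the
half-diagonal window is positive. -/
theorem deepTameVanishing_of_sixFeet {cls : Set E3 → Prop} {r_f dstar s lam ℓ τ ϱ ϱχ r₁ r₂ ρlo ρhi : ℝ}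
    (hϱχ : 0 < ϱχ) (hr₁ : 0 ≤ r₁) (hsmall : 2 * (r₁ + r₂) < ϱχ / 2) (hlo : 0 < ρlo)
    (hZ : SixFeetZeroConeQ ρlo ρhi r_f dstar ϱ) :
    DeepTameVanishingQ cls r_f dstar s lam ℓ τ ϱ ϱχ r₁ r₂ ρlo ρhi := by
  intro P C X m D σ _ _ _ _ _ _ _ _ hFr y hy z hz hd1 hd2 hclean hplat hcf htm hdp
  obtain ⟨c, f, ρ, q, hf, hρ, hρ1, hρ2, hyv, hzv, hO, hdiam, hfd, -, -, hfun⟩ :=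
    tame_frame (σ := σ) (X := X) (ϱ := ϱ) hϱχ hr₁ hsmall hlo hFr hy hz hd1 hd2 hclean hplat hcf htm
  have hvert : ∀ u : Fin 3 × Bool, InOct P r₁ y z (octVertex c f ρ u.1 u.2) := fun u => (hO _).2 ⟨u.1, u.2, rfl⟩
  have hzero : roofVal T75 (fun p : Fin 3 × Bool => siteW ϱχ D σ X ϱ C (octVertex c f ρ p.1 p.2)) = 0 := by
    rw [hfun]
    exact hZ ρ hρ1 hρ2 c f hf q hdiam fun u => by rw [hfd]; exact hdp _ (hvert u)
  have hmem : (τ * (2 * ρ)) ^ 2 * roofVal T75 (fun p : Fin 3 × Bool => siteW ϱχ D σ X ϱ C (octVertex c f ρ p.1 p.2)) ∈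
      frameValSet (roofVal T75) τ (siteW ϱχ D σ X ϱ C) P r₁ y z :=
    ⟨c, f, ρ, hf, hρ, hyv, hzv, hO, rfl⟩
  rw [hzero, mul_zero] at hmem
  exact frameVal_le_of_mem hmem le_rfl le_rfl

/-- ★★★ **THE BRIDGE (S♯) ∧ (I₃₆) ⟹ (S) (PROVED)**: the shallow cap charges each S-hole `κ` per layer vertex; the layer vertices of an S-hole are
S-vertices (witnessed by the hole itself) and pairwise distinct, so the charge is at most `κ ·` (incidence sum of the S-vertex indicator); the
termwise transfer and the incidence count turn this into `6κ · sVertMassL` (`N_I = 36`, the `1/6` of the ledger). -/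
theorem shallowTameCharge_of_cap {cls : Set E3 → Prop} {r_f dstar κ s lam ℓ τ ϱ ϱχ r₁ r₂ ρlo ρhi : ℝ}
    (hs : 0 < s) (hκ : 0 ≤ κ) (hϱχ : 0 < ϱχ) (hr₁ : 0 ≤ r₁) (hsmall : 2 * (r₁ + r₂) < ϱχ / 2) (hlo : 0 < ρlo)
    (hCap : SixFeetShallowCapQ ρlo ρhi r_f dstar ϱ τ κ) (hI : SVertexIncidenceQ cls r_f dstar 36 s lam ℓ ϱ ϱχ r₁ r₂) :
    ShallowTameChargeQ cls r_f dstar κ s lam ℓ τ ϱ ϱχ r₁ r₂ ρlo ρhi := by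
  intro P C X m D σ h1 h2 hcl h3 h4 h6 h7 h11 hFr
  have hinc := hI P C X m D σ h1 h2 hcl h6 h7 h11
  -- termwise: (1/6)·frameVal ≤ (κ/6)·octIncid(sVertInd) on S-holes
  have hterm := fShellSel_le_of_termwise (ϱχ := ϱχ) (D := D) (σ := σ)
    (π := fun y z => (OctChiFree ϱχ D P r₁ y z ∧ OctTame r_f C P r₁ y z) ∧ ¬OctDeep dstar C P r₁ y z) h1 hs (F := roofVal T75)
    (r₁ := r₁) (r₂ := r₂) (τ := τ) (X := X) (ϱ := ϱ) (C := C)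
    (fun y z => κ / 6 * octIncid (sVertInd ϱχ D σ r_f dstar P C X ϱ r₁ r₂) P r₁ y z)
    (fun y z => mul_nonneg (by positivity) (octIncid_sVertInd_nonneg ϱχ D σ r_f dstar P C X ϱ r₁ r₂ y z)) ?_
  · refine hterm.trans ?_
    have hrw : (∑ y ∈ P.motif, ∑ᶠ z : E3, if z ∈ P.points ∧ r₁ < dist y z ∧ dist y z ≤ r₂ then
          κ / 6 * octIncid (sVertInd ϱχ D σ r_f dstar P C X ϱ r₁ r₂) P r₁ y z else 0) =
        κ / 6 * ∑ y ∈ P.motif, ∑ᶠ z : E3, (if z ∈ P.points ∧ r₁ < dist y z ∧ dist y z ≤ r₂ then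
          octIncid (sVertInd ϱχ D σ r_f dstar P C X ϱ r₁ r₂) P r₁ y z else 0) := by
      rw [Finset.mul_sum]
      refine Finset.sum_congr rfl fun y _ => ?_
      rw [mul_finsum]
      refine finsum_congr fun z => ?_
      split_ifs
      · rfl
      · rw [mul_zero]
    rw [hrw]
    have h36 := mul_le_mul_of_nonneg_left hinc (by positivity : (0 : ℝ) ≤ κ / 6)
    linarith
  · intro y hy z hz hd1 hd2 hclean hplat hπ
    obtain ⟨⟨hcf, htm⟩, hndp⟩ := hπ
    have hy' : y ∈ P.points := P.mem_points_of_mem_motif hy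
    obtain ⟨c, f, ρ, q, hf, hρ, hρ1, hρ2, hyv, hzv, hO, hdiam, hfd, hlf, -, hfun⟩ :=
      tame_frame (σ := σ) (X := X) (ϱ := ϱ) hϱχ hr₁ hsmall hlo hFr hy' hz hd1 hd2 hclean hplat hcf htm
    have hvert : ∀ u : Fin 3 × Bool, InOct P r₁ y z (octVertex c f ρ u.1 u.2) := fun u => (hO _).2 ⟨u.1, u.2, rfl⟩
    -- some vertex is shallow
    have hsh : ∃ u, feetDepth c f ρ q u < dstar := by
      unfold OctDeep at hndp
      push Not at hndp
      obtain ⟨x, hx, hlt⟩ := hndp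
      obtain ⟨i, b, rfl⟩ := (hO x).1 hx
      exact ⟨(i, b), by rw [hfd]; exact hlt⟩
    have hcap := hCap ρ hρ1 hρ2 c f hf q hdiam hsh
    -- the layer vertices are distinct S-vertices of the octahedron: layerCount ≤ incidence sum
    have hcount : layerCount ϱ c f ρ q ≤ octIncid (sVertInd ϱχ D σ r_f dstar P C X ϱ r₁ r₂) P r₁ y z := by
      unfold octIncid layerCount
      have hF := h1.finite_inter_closedBall hs y (r₁ + r₂)
      set T' : Finset E3 := hF.toFinset with hT'
      have hmemT' : ∀ x, InOct P r₁ y z x → x ∈ T' := fun x hx => by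
        rw [hT', Set.Finite.mem_toFinset]
        exact ⟨hx.1, Metric.mem_closedBall.2 (by rw [dist_comm]; exact dist_le_of_inOct hr₁ hd2 hx)⟩
      have hg0 : ∀ x, 0 ≤ (if InOct P r₁ y z x then sVertInd ϱχ D σ r_f dstar P C X ϱ r₁ r₂ x else 0) := fun x => by
        split_ifs
        · exact sVertInd_nonneg _ _ _ _ _ _ _ _ _
        · exact le_rfl
      rw [finsum_eq_sum_of_support_subset (s := T')]
      · have hinj := octVertex_injective (c := c) hf hρ.ne'
        calc (∑ u : Fin 3 × Bool, if 0 < depthProfile ϱ (feetDepth c f ρ q u) ∧ depthProfile ϱ (feetDepth c f ρ q u) < 1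
                then (1 : ℝ) else 0)
            ≤ ∑ u : Fin 3 × Bool, (if InOct P r₁ y z (octVertex c f ρ u.1 u.2) then
                sVertInd ϱχ D σ r_f dstar P C X ϱ r₁ r₂ (octVertex c f ρ u.1 u.2) else 0) := by
              refine Finset.sum_le_sum fun u _ => ?_
              by_cases hl : 0 < depthProfile ϱ (feetDepth c f ρ q u) ∧ depthProfile ϱ (feetDepth c f ρ q u) < 1
              · rw [if_pos hl, if_pos (hvert u)]
                unfold sVertInd
                rw [if_pos]
                refine ⟨⟨hclean _ (hvert u), ?_, hlf _ (hvert u)⟩, y, z, ⟨hy', hz, hd1, hd2, hclean, hplat, ⟨hcf, htm⟩, hndp⟩, hvert u⟩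
                rw [profileWeight_eq_depthProfile, ← hfd u]
                exact hl
              · rw [if_neg hl]
                exact hg0 _
          _ = ∑ x ∈ (Finset.univ : Finset (Fin 3 × Bool)).image (fun u : Fin 3 × Bool => octVertex c f ρ u.1 u.2),
                (if InOct P r₁ y z x then sVertInd ϱχ D σ r_f dstar P C X ϱ r₁ r₂ x else 0) := by
              rw [Finset.sum_image fun u _ u' _ h => hinj h]
          _ ≤ ∑ x ∈ T', (if InOct P r₁ y z x then sVertInd ϱχ D σ r_f dstar P C X ϱ r₁ r₂ x else 0) := by
              refine Finset.sum_le_sum_of_subset_of_nonneg (fun x hx => ?_) (fun x _ _ => hg0 x)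
              obtain ⟨u, -, rfl⟩ := Finset.mem_image.1 hx
              exact hmemT' _ (hvert u)
      · intro x hx
        by_contra hxT
        exact (Function.mem_support.1 hx) (if_neg fun h' => hxT (hmemT' x h'))
    -- the anchored frame value bounds the frame-infimum
    have hmem : (τ * (2 * ρ)) ^ 2 * roofVal T75 (fun p : Fin 3 × Bool => siteW ϱχ D σ X ϱ C (octVertex c f ρ p.1 p.2)) ∈
        frameValSet (roofVal T75) τ (siteW ϱχ D σ X ϱ C) P r₁ y z :=
      ⟨c, f, ρ, hf, hρ, hyv, hzv, hO, rfl⟩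
    rw [hfun] at hmem
    have hN0 := octIncid_sVertInd_nonneg ϱχ D σ r_f dstar P C X ϱ r₁ r₂ y z
    have hfv : frameVal (roofVal T75) τ (siteW ϱχ D σ X ϱ C) P r₁ y z ≤
        κ * octIncid (sVertInd ϱχ D σ r_f dstar P C X ϱ r₁ r₂) P r₁ y z :=
      frameVal_le_of_mem hmem (hcap.trans (mul_le_mul_of_nonneg_left hcount hκ)) (mul_nonneg hκ hN0)
    linarith

/-- ★★★ **GLUE OF NODE 76 WITH THE BRIDGES (PROVED)**: (Z₀) ∧ (S♯) ∧ (I₃₆) ∧ (KX) ⟹ (G_T), for any class, any `κ ≥ 0`, any separation `s > 0`,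
octahedra small against the χ-scale, positive half-diagonal window.  No relation between `κ` and `c_T` is needed. -/
theorem roofLedgerQ_of_cover {cls : Set E3 → Prop} {r_f dstar κ s lam ℓ τ ϱ ϱχ r₁ r₂ ρlo ρhi c_T cχ : ℝ}
    (hs : 0 < s) (hκ : 0 ≤ κ) (hϱχ : 0 < ϱχ) (hr₁ : 0 ≤ r₁) (hsmall : 2 * (r₁ + r₂) < ϱχ / 2) (hlo : 0 < ρlo)
    (hZ : SixFeetZeroConeQ ρlo ρhi r_f dstar ϱ) (hCap : SixFeetShallowCapQ ρlo ρhi r_f dstar ϱ τ κ)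
    (hI : SVertexIncidenceQ cls r_f dstar 36 s lam ℓ ϱ ϱχ r₁ r₂)
    (hKX : CreaseTransitionLedgerQ cls r_f dstar κ s lam ℓ τ ϱ ϱχ r₁ r₂ ρlo ρhi c_T cχ) :
    RoofLedgerQ cls s lam ℓ τ ϱ ϱχ r₁ r₂ ρlo ρhi c_T cχ :=
  roofLedgerQ_of_classes hs (deepTameVanishing_of_sixFeet hϱχ hr₁ hsmall hlo hZ)
    (shallowTameCharge_of_cap hs hκ hϱχ hr₁ hsmall hlo hCap hI) hKX

end Bridge

/-! ## §5 The designate: NODE 76 beneath NODE 75, and the q-designate cone through the cover -/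

section Designate

/-- The exact class of the designate (cubic fcc image at the pinned scale). -/
abbrev cls₀ : Set E3 → Prop := IsCubicFccImage (Fcc.a0 * Real.sqrt 2) (Fcc.a0 * Real.sqrt 2)

/-- ★★★ **NODE 76 AT THE DESIGNATE (PROVED)**: with `r_f = 20`, `d⋆ = 106`, `κ = c_T/60 = 1/3600000000`, `N_I = 36`:
(Z₀) ∧ (S♯) ∧ (I₃₆) ∧ (KX) ⟹ (G_T) `RoofLedgerQ cls₀ (3/5) (1/3) 3 (3/100) 160 80 (6/5) (3/2) (679/1000) (691/1000) (1/60000000) (1/2000000)`. -/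
theorem roofLedgerQ_designate_of_cover
    (hZ : SixFeetZeroConeQ (679 / 1000) (691 / 1000) 20 106 160)
    (hCap : SixFeetShallowCapQ (679 / 1000) (691 / 1000) 20 106 160 (3 / 100) (1 / 3600000000))
    (hI : SVertexIncidenceQ cls₀ 20 106 36 (3 / 5) (1 / 3) 3 160 80 (6 / 5) (3 / 2))
    (hKX : CreaseTransitionLedgerQ cls₀ 20 106 (1 / 3600000000) (3 / 5) (1 / 3) 3 (3 / 100) 160 80 (6 / 5) (3 / 2) (679 / 1000)
      (691 / 1000) (1 / 60000000) (1 / 2000000)) :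
    RoofLedgerQ cls₀ (3 / 5) (1 / 3) 3 (3 / 100) 160 80 (6 / 5) (3 / 2) (679 / 1000) (691 / 1000) (1 / 60000000) (1 / 2000000) :=
  roofLedgerQ_of_cover (by norm_num) (by norm_num) (by norm_num) (by norm_num) (by norm_num) (by norm_num) hZ hCap hI hKX

/-- ★★★ **THE q-DESIGNATE THROUGH THE COVER**: the tree cone `chargedEnergyGap_of_roofLedger_numerics` with (G_T) replaced by the four
leaves of NODE 76 — (Z₀) `SixFeetZeroConeQ`, (S♯) `SixFeetShallowCapQ`, (I₃₆) `SVertexIncidenceQ`, (KX) `CreaseTransitionLedgerQ` —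
everything else verbatim. -/
theorem chargedEnergyGap_of_roofCover_numerics {b₁ : ℝ} (hb : 1 / 8 ≤ b₁) (hU : Fcc.FccScaleNumerics) (hF : ChargeRecount)
    (hIP : ImprovablePricingG (3 / 20) (1 / 10) (6 / 5) 10 (1 / 100) (3 / 5))
    (hFCP : FrustratedCorePricingG (3 / 20) (1 / 10) (6 / 5) 10 (1 / 100) 40 (3 / 5))
    (hCCP : CoherentCorePricingG (3 / 20) (1 / 10) (6 / 5) 10 (1 / 100) 40 (1 / 10) 40 (3 / 5))
    (hB : CoreBallRegularPricingW (maxCoverWeights (3 / 20) (1 / 10) (6 / 5) 10 (1 / 100) 40 (1 / 10) 40 160) (1 / 20) (3 / 5) 10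
      fun _ _ => True)
    (hLab : CleanLabellingW (maxCoverWeights (3 / 20) (1 / 10) (6 / 5) 10 (1 / 100) 40 (1 / 10) 40 160) (3 / 5) 10 (1 / 3) 3)
    (hSB : ShellBudgetW (maxCoverWeights (3 / 20) (1 / 10) (6 / 5) 10 (1 / 100) 40 (1 / 10) 40 160) (3 / 5) 100000)
    (hLf : LoadBoundQ IsFccImage (3 / 5) (1 / 3) 3 (1 / 100) (3 / 100) 160 (2 / 5) 3 b₁ 80 (6 / 5) (3 / 4) (3 / 10000000) (9 / 1000000))
    (hNf : NnStiffCls IsFccImage (27 / 10) (6 / 5))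
    (hOL : OctLedgerQ (IsCubicFccImage (1921 / 2000) (977 / 1000)) (3 / 5) (1 / 3) 3 (1 / 100) (3 / 100) 160 (2 / 5) 3 b₁ 80 (6 / 5) (3 / 2)
      (1 / 2) (679 / 1000) (691 / 1000))
    (hA : A0Plus) (hSh : ShellIsSecond (IsCubicFccImage (Fcc.a0 * Real.sqrt 2) (Fcc.a0 * Real.sqrt 2)))
    (hT : RoofTableQ (471 / 1000) T75)
    (hZ : SixFeetZeroConeQ (679 / 1000) (691 / 1000) 20 106 160)
    (hCap : SixFeetShallowCapQ (679 / 1000) (691 / 1000) 20 106 160 (3 / 100) (1 / 3600000000))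
    (hI : SVertexIncidenceQ cls₀ 20 106 36 (3 / 5) (1 / 3) 3 160 80 (6 / 5) (3 / 2))
    (hKX : CreaseTransitionLedgerQ cls₀ 20 106 (1 / 3600000000) (3 / 5) (1 / 3) 3 (3 / 100) 160 80 (6 / 5) (3 / 2) (679 / 1000)
      (691 / 1000) (1 / 60000000) (1 / 2000000))
    (hFf : FarTrussQ IsFccImage (3 / 5) (1 / 3) 3 (1 / 100) (3 / 100) 160 (2 / 5) 3 b₁ 80 (6 / 5) (3 / 2) (11 / 20) (1 / 25) (1 / 60000000)
      (1 / 2000000))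
    (hGf : GeoExchQ IsFccImage (3 / 5) (1 / 3) 3 (1 / 100) (3 / 100) 160 (2 / 5) 3 b₁ 80 (6 / 5) (3 / 20) (1 / 25) (1 / 30000000) (1 / 1000000))
    (hLh : LoadBoundQ IsHcpImage (3 / 5) (1 / 3) 3 (1 / 100) (3 / 100) 160 (2 / 5) 3 b₁ 80 (6 / 5) (3 / 4) (3 / 10000000) (9 / 1000000))
    (hNh : NnStiffCls IsHcpImage (27 / 10) (6 / 5))
    (hMh : MidTrussQ IsHcpImage (3 / 5) (1 / 3) 3 (1 / 100) (3 / 100) 160 (2 / 5) 3 b₁ 80 (6 / 5) (3 / 2) (1 / 2) 0 (1 / 60000000) (1 / 2000000))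
    (hFh : FarTrussQ IsHcpImage (3 / 5) (1 / 3) 3 (1 / 100) (3 / 100) 160 (2 / 5) 3 b₁ 80 (6 / 5) (3 / 2) (1 / 2) (1 / 40) (1 / 60000000)
      (1 / 2000000))
    (hGh : GeoExchQ IsHcpImage (3 / 5) (1 / 3) 3 (1 / 100) (3 / 100) 160 (2 / 5) 3 b₁ 80 (6 / 5) (1 / 5) (1 / 40) (1 / 30000000) (1 / 1000000))
    (hN : LocalSeamReductionQ (3 / 5) (1 / 3) 3 (1 / 100) (3 / 100) (1 / 2) 160 (2 / 5) 3 b₁ 80 (1 / 3000000) (1 / 100000)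
      (maxCoverWeights (3 / 20) (1 / 10) (6 / 5) 10 (1 / 100) 40 (1 / 10) 40 160) (1 / 20) 10 100000)
    (hP : ChartedChargePricingG (3 / 20) (1 / 10) (3 / 5)) : ChargedEnergyGap :=
  chargedEnergyGap_of_roofLedger_numerics hb hU hF hIP hFCP hCCP hB hLab hSB hLf hNf hOL hA hSh hT
    (roofLedgerQ_designate_of_cover hZ hCap hI hKX) hFf hGf hLh hNh hMh hFh hGh hN hP

end Designate

end Summit.AtomisticToContinuum.Crystallization.Theorems.ChargedEnergyGapChartDial
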